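import Summits.ValiantsHypothesis.ValiantsHypothesis.Theorems.KPlusLogSqLawStaticPathGapCharging
import Summits.ValiantsHypothesis.ValiantsHypothesis.Theorems.KPlusLogSqLawStaticPathTwoChainsSteps

/-!
# Route «KPlusLogSqLaw» — parametric max-weight independent set on a path: ANATOMY OF THE CHARGED SILENT FLIPS, II: the left end exits only through its ℓ-bit

HONEST FRAMING.  Helper toward the crux `WeakLifting` (item `stmt-ValiantsHypothesis-19561`, route `KPlusLogSqLaw`, cell `pub-symmetroid`,
seat val-sym-lift-p4 g24, 2026-08-29) on the line of its witness-plan stub `stub_tridiagonalSectorB` (tropical twin of the STATIC tridiagonal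
sector = parametric maximum-weight independent set on a path; located theory `HOME/val-sym-lift-p4/SILENT-FLIP-LAW.md` §5 «anatomy of the
charged silent flips», PROPOSITION (a)/(b) and the (α)/(γ) conditions).  Sequel of `…StaticPathTwoChainsSteps` in the abstract TWO-CHAIN
PROCESS setting of `…StaticPathSilentFlipsCases` (states `(S k, Lr k, Rr k)`, greedy semantics of offset `e`, adjacent transpositions reversing
one pair each, each pair once).  Consider an event `(u, v)` at step `t` whose closed gap `[u, v]` is FROZEN (no record-membership change) up to a
step `s` at which one END of the gap leaves the record set, `u` not being a left end again in `(t, s]`: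
* `leftEnd_exit_is_left_flip` — (b)+(γ): if the left end `u` exits at `s`, the exit is a LEFT flip (`u` is the larger label of the pair acted on
  at `s`, i.e. it leaves through its ℓ-bit, never through its r-bit) and `u` LOST ITS PARTICLE at the event (`u` was a right record at `t`: hop
  `u → v` or annihilation).  Part I (`…SilentFlipsAnatomyPartner`): the partner exits only through its r-bit.  (The right-end version of the
  window hypothesis — `v` not a right end again — is the mirror statement and is not needed for the left charging of THEOREM A.)  Pure finite combinatorics; nothing here asserts anything about `WeakLifting`, `TropicalB`, `KPlusLogSqLaw`, the stub in its window,
`MatrixDescartes` (stmt-ValiantsHypothesis-18050) or `VP ≠ VNP`; the ORDER QUESTION stays open.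
-/

set_option linter.dupNamespace false
set_option autoImplicit false

namespace Summit.ValiantsHypothesis.ValiantsHypothesis.Theorems.KPlusLogSqLaw

open Finset Classical

namespace StaticPathFold

section Anatomy

variable {β : Type*} [LinearOrder β]

/-- **(b)+(γ): THE LEFT END EXITS ONLY THROUGH ITS ℓ-BIT, AND ONLY AFTER LOSING ITS PARTICLE.**  Event `(u, v) = (x t, y t)` at `t`, closed gap
frozen on `[t, s]`, `u` not a left end again in `(t, s]`, and `u` leaves the record set at step `s`.  Then `u = y s` (a left flip: `u` is the
larger label of the pair acted on at `s`) and `u` was a right record at `t` (it lost its r-bit, i.e. its particle, at the event). [folklore] -/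
theorem leftEnd_exit_is_left_flip (S : ℕ → ℕ → β) (e n T : ℕ) (x y : ℕ → ℕ) {Lr Rr : ℕ → ℕ → Prop}
    (hxy : ∀ k, k < T → x k < y k ∧ y k ≤ n)
    (hL0 : ∀ k, k ≤ T → Lr k 0) (hRn : ∀ k, k ≤ T → Rr k n)
    (hSem : ∀ k, k ≤ T → ∀ p u, p < u → u ≤ n → Lr k p → (∀ q, p < q → q < u → ¬ Lr k q) →
      (Lr k u ↔ ((Even (u + e) → S k u < S k p) ∧ (¬ Even (u + e) → S k p < S k u))))
    (hSemR : ∀ k, k ≤ T → ∀ u r, u < r → r ≤ n → Rr k r → (∀ q, u < q → q < r → ¬ Rr k q) →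
      (Rr k u ↔ ((Even (u + e) → S k u < S k r) ∧ (¬ Even (u + e) → S k r < S k u))))
    (hord : ∀ k, k < T → ∀ p q, p ≤ n → q ≤ n → ¬(p = x k ∧ q = y k) → ¬(p = y k ∧ q = x k) →
      (S k p < S k q ↔ S (k + 1) p < S (k + 1) q))
    (hdis : ∀ k, k ≤ T → ∀ p q, p ≤ n → q ≤ n → p ≠ q → S k p ≠ S k q)
    (hadj : ∀ k, k < T → ∀ q, q ≤ n → q ≠ x k → q ≠ y k → (S k q < S k (x k) ↔ S k q < S k (y k)))
    (hflip : ∀ k, k < T → (S k (x k) < S k (y k) ↔ ¬ S (k + 1) (x k) < S (k + 1) (y k)))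
    (honce : ∀ k, k < T → ∀ k', k' < T → x k = x k' → y k = y k' → k = k')
    {t s : ℕ} (hts : t < s) (hsT : s < T)
    (hEt : Lr t (x t) ∧ Rr t (y t) ∧ ∀ q, x t < q → q < y t → ¬ Lr t q ∧ ¬ Rr t q)
    (hfr : ∀ τ, t ≤ τ → τ ≤ s → ∀ w, x t ≤ w → w ≤ y t → ((Lr τ w ∨ Rr τ w) ↔ (Lr t w ∨ Rr t w)))
    (hnx : ∀ k, t < k → k ≤ s → (Lr k (x k) ∧ Rr k (y k) ∧ ∀ q, x k < q → q < y k → ¬ Lr k q ∧ ¬ Rr k q) → x k ≠ x t)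
    (hexit : ¬ Lr (s + 1) (x t) ∧ ¬ Rr (s + 1) (x t)) :
    x t = y s ∧ Rr t (x t) := by
  obtain ⟨huz, hzn⟩ := hxy t (by omega)
  have hun : x t ≤ n := by omega
  obtain ⟨hLu, hRz, hgap⟩ := hEt
  /- ### step lemmas instantiated along the process -/
  have hLfl : ∀ k, k < T → ∀ w, w ≤ n → ¬ (Lr (k + 1) w ↔ Lr k w) →
      w = y k ∧ (Lr k (x k) ∧ ∀ q, x k < q → q < y k → ¬ Lr k q) ∧
        (Lr (k + 1) (x k) ∧ ∀ q, x k < q → q < y k → ¬ Lr (k + 1) q) ∧ (Rr k (y k) → ∀ q, x k < q → q < y k → ¬ Rr k q) :=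
    fun k hk w hw hch => left_flip_cases (S k) (S (k + 1)) e n (x k) (y k) (hxy k hk).1 (hxy k hk).2 (hL0 k hk.le)
      (hL0 (k + 1) (by omega)) (hSem k hk.le) (hSem (k + 1) (by omega)) (hSemR k hk.le) (hord k hk) (hdis k hk.le) (hadj k hk) hw hch
  have hRfl : ∀ k, k < T → ∀ w, w ≤ n → ¬ (Rr (k + 1) w ↔ Rr k w) →
      w = x k ∧ (Rr k (y k) ∧ ∀ q, x k < q → q < y k → ¬ Rr k q) ∧
        (Rr (k + 1) (y k) ∧ ∀ q, x k < q → q < y k → ¬ Rr (k + 1) q) ∧ (Lr k (x k) → ∀ q, x k < q → q < y k → ¬ Lr k q) :=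
    fun k hk w hw hch => right_flip_cases (S k) (S (k + 1)) e n (x k) (y k) (hxy k hk).1 (hxy k hk).2 (hRn k hk.le)
      (hRn (k + 1) (by omega)) (hSem k hk.le) (hSemR k hk.le) (hSemR (k + 1) (by omega)) (hord k hk) (hdis k hk.le) (hadj k hk) hw hch
  have hEvf : ∀ k, k < T → (Lr k (x k) ∧ Rr k (y k) ∧ ∀ q, x k < q → q < y k → ¬ Lr k q ∧ ¬ Rr k q) →
      (Lr (k + 1) (y k) ↔ ¬ Lr k (y k)) ∧ (Rr (k + 1) (x k) ↔ ¬ Rr k (x k)) ∧ Lr (k + 1) (x k) ∧ Rr (k + 1) (y k) :=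
    fun k hk hev => event_flips (S k) (S (k + 1)) e n (x k) (y k) (hxy k hk).1 (hxy k hk).2 (hL0 k hk.le) (hL0 (k + 1) (by omega))
      (hRn k hk.le) (hRn (k + 1) (by omega)) (hSem k hk.le) (hSem (k + 1) (by omega)) (hSemR k hk.le) (hSemR (k + 1) (by omega))
      (hord k hk) (hdis k hk.le) (hdis (k + 1) (by omega)) (hadj k hk) (hflip k hk) hev.1 (fun q h1 h2 => (hev.2.2 q h1 h2).1) hev.2.1
      (fun q h1 h2 => (hev.2.2 q h1 h2).2)
  -- (F4): a bit flip is an event at that label's end or a membership change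
  have hLsil : ∀ k, k < T → ∀ w, w ≤ n → ¬ (Lr (k + 1) w ↔ Lr k w) →
      (w = y k ∧ Lr k (x k) ∧ Rr k (y k) ∧ ∀ q, x k < q → q < y k → ¬ Lr k q ∧ ¬ Rr k q) ∨
        ¬ ((Lr (k + 1) w ∨ Rr (k + 1) w) ↔ (Lr k w ∨ Rr k w)) := by
    intro k hk w hw hch
    obtain ⟨hwy, ⟨hLx, hnoL⟩, -, hR⟩ := hLfl k hk w hw hch
    by_cases hRw : Rr k w
    · left
      refine ⟨hwy, hLx, hwy ▸ hRw, fun q h1 h2 => ⟨hnoL q h1 h2, hR (hwy ▸ hRw) q h1 h2⟩⟩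
    · right
      have hRw' : ¬ Rr (k + 1) w := by
        intro h
        have hch' : ¬ (Rr (k + 1) w ↔ Rr k w) := fun hiff => hRw (hiff.mp h)
        have := (hRfl k hk w hw hch').1
        have := (hxy k hk).1
        omega
      intro hiff
      apply hch
      constructor
      · intro h; rcases hiff.mp (Or.inl h) with h' | h'
        · exact h'
        · exact absurd h' hRw
      · intro h; rcases hiff.mpr (Or.inl h) with h' | h'
        · exact h'
        · exact absurd h' hRw'
  have hRsil : ∀ k, k < T → ∀ w, w ≤ n → ¬ (Rr (k + 1) w ↔ Rr k w) →
      (w = x k ∧ Lr k (x k) ∧ Rr k (y k) ∧ ∀ q, x k < q → q < y k → ¬ Lr k q ∧ ¬ Rr k q) ∨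
        ¬ ((Lr (k + 1) w ∨ Rr (k + 1) w) ↔ (Lr k w ∨ Rr k w)) := by
    intro k hk w hw hch
    obtain ⟨hwx, ⟨hRy, hnoR⟩, -, hL⟩ := hRfl k hk w hw hch
    by_cases hLw : Lr k w
    · left
      refine ⟨hwx, hwx ▸ hLw, hRy, fun q h1 h2 => ⟨hL (hwx ▸ hLw) q h1 h2, hnoR q h1 h2⟩⟩
    · right
      have hLw' : ¬ Lr (k + 1) w := by
        intro h
        have hch' : ¬ (Lr (k + 1) w ↔ Lr k w) := fun hiff => hLw (hiff.mp h)
        have := (hLfl k hk w hw hch').1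
        have := (hxy k hk).1
        omega
      intro hiff
      apply hch
      constructor
      · intro h; rcases hiff.mp (Or.inr h) with h' | h'
        · exact absurd h' hLw
        · exact h'
      · intro h; rcases hiff.mpr (Or.inr h) with h' | h'
        · exact absurd h' hLw'
        · exact h'
  -- order persistence of a pair that is not acted on
  have hpers : ∀ p q k₁ k₂, p ≤ n → q ≤ n → p < q → k₁ ≤ k₂ → k₂ ≤ T →
      (∀ k, k₁ ≤ k → k < k₂ → ¬ (x k = p ∧ y k = q)) → (S k₂ p < S k₂ q ↔ S k₁ p < S k₁ q) := by
    intro p q k₁ k₂ hp hq hpq hk hk2 hno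
    refine iff_of_steps (P := fun k => S k p < S k q) hk (fun k h1 h2 => ?_)
    have hkT : k < T := by omega
    exact (hord k hkT p q hp hq (fun h => hno k h1 h2 ⟨h.1.symm, h.2.symm⟩)
      (fun h => by have := (hxy k hkT).1; omega)).symm
  -- no event with right end `z` in `(t, s]`
  have hnoRz : ∀ k, t < k → k ≤ s → (Lr k (x k) ∧ Rr k (y k) ∧ ∀ q, x k < q → q < y k → ¬ Lr k q ∧ ¬ Rr k q) →
      y k ≠ y t := by
    intro k hk1 hk2 hev hyk
    obtain ⟨hLx, -, hg⟩ := hev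
    have hkT : k < T := by omega
    obtain ⟨hxk, -⟩ := hxy k hkT
    rcases Nat.lt_trichotomy (x k) (x t) with h | h | h
    · have h1 := hg (x t) h (by omega)
      have h2 := (hfr k hk1.le hk2 (x t) le_rfl huz.le).mpr (Or.inl hLu)
      exact h2.elim h1.1 h1.2
    · exact absurd (honce k hkT t (by omega) h hyk) (by omega)
    · have h1 := hgap (x k) h (by omega)
      have h2 := (hfr k hk1.le hk2 (x k) h.le (by omega)).mp (Or.inl hLx)
      exact h2.elim h1.1 h1.2
  -- bits of the two ends are constant after the event step
  have hLz_const : ∀ k, t + 1 ≤ k → k < s → (Lr (k + 1) (y t) ↔ Lr k (y t)) := by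
    intro k hk1 hk2
    by_contra hch
    rcases hLsil k (by omega) (y t) hzn hch with ⟨hwy, hev⟩ | hmem
    · exact hnoRz k (by omega) hk2.le hev hwy.symm
    · exact hmem ((hfr (k + 1) (by omega) (by omega) (y t) huz.le le_rfl).trans
        (hfr k (by omega) hk2.le (y t) huz.le le_rfl).symm)
  have hRu_const : ∀ k, t + 1 ≤ k → k < s → (Rr (k + 1) (x t) ↔ Rr k (x t)) := by
    intro k hk1 hk2
    by_contra hch
    rcases hRsil k (by omega) (x t) hun hch with ⟨hwx, hev⟩ | hmem
    · exact hnx k (by omega) hk2.le hev hwx.symm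
    · exact hmem ((hfr (k + 1) (by omega) (by omega) (x t) le_rfl huz.le).trans
        (hfr k (by omega) hk2.le (x t) le_rfl huz.le).symm)
  obtain ⟨hfLz, hfRu, -, -⟩ := hEvf t (by omega) ⟨hLu, hRz, hgap⟩
  -- heights: the pair `(u, z)` flipped at `t` and never again
  have hper : S s (x t) < S s (y t) ↔ S (t + 1) (x t) < S (t + 1) (y t) :=
    hpers (x t) (y t) (t + 1) s hun hzn huz (by omega) hsT.le (fun k h1 h2 h =>
      absurd (honce k (by omega) t (by omega) h.1 h.2) (by omega))
  have hft := hflip t (by omega)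
  -- suppose the exit is a RIGHT flip of `u = x t` at `s`
  by_contra hcon
  have hRs : Rr s (x t) := by
    by_contra hRs
    have hLs : Lr s (x t) := by
      rcases (hfr s hts.le le_rfl (x t) le_rfl huz.le).mpr (Or.inl hLu) with h | h
      · exact h
      · exact absurd h hRs
    have hchL : ¬ (Lr (s + 1) (x t) ↔ Lr s (x t)) := fun h => hexit.1 (h.mpr hLs)
    have hux : x t = y s := (hLfl s hsT (x t) hun hchL).1
    -- then `Rr t u`: the right bit is constant on `[t+1, s]`, off at `s`, so off at `t+1`, so on at `t`
    have hRt1 : ¬ Rr (t + 1) (x t) := fun h =>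
      hRs ((iff_of_steps (P := fun k => Rr k (x t)) (show t + 1 ≤ s by omega) (fun k h1 h2 => hRu_const k h1 h2)).mpr h)
    have hRt : Rr t (x t) := by
      by_contra h
      exact hRt1 (by rwa [hfRu])
    exact hcon ⟨hux, hRt⟩
  -- so the exit at `s` is a right flip: `u = x s`, `y₀ = y s` its nearest right record at `s`
  have hchs : ¬ (Rr (s + 1) (x t) ↔ Rr s (x t)) := fun h => hexit.2 (h.mpr hRs)
  obtain ⟨huxs, ⟨hRy0, hnoy0⟩, -, -⟩ := hRfl s hsT (x t) hun hchs
  obtain ⟨huy0, hy0n⟩ := hxy s hsT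
  rw [← huxs] at huy0 hnoy0
  -- `r(u)` constant on `[t+1, s]`, on at `s`, so on at `t+1`, off at `t`: the event turned it on (hop `z → u` or creation)
  have hRu_t1 : Rr (t + 1) (x t) :=
    (iff_of_steps (P := fun k => Rr k (x t)) (show t + 1 ≤ s by omega) (fun k h1 h2 => hRu_const k h1 h2)).mp hRs
  have hRu_t : ¬ Rr t (x t) := fun h => (hfRu.mp hRu_t1) h
  -- `y₀ > z`
  have hy0z : y t < y s := by
    rcases Nat.lt_trichotomy (y s) (y t) with h | h | h
    · have h1 := hgap (y s) huy0 h
      have h2 := (hfr s hts.le le_rfl (y s) huy0.le h.le).mp (Or.inr hRy0)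
      exact (h2.elim h1.1 h1.2).elim
    · exact absurd (honce s hsT t (by omega) huxs.symm h) (by omega)
    · exact h
  have hRz_s : ¬ Rr s (y t) := hnoy0 (y t) huz hy0z
  have hLz_s : Lr s (y t) := by
    rcases (hfr s hts.le le_rfl (y t) huz.le le_rfl).mpr (Or.inr hRz) with h | h
    · exact h
    · exact absurd h hRz_s
  have hgood_z : ¬ ((Even (y t + e) → S s (y t) < S s (y s)) ∧ (¬ Even (y t + e) → S s (y s) < S s (y t))) := by
    rw [← hSemR s hsT.le (y t) (y s) hy0z hy0n hRy0 (fun q h1 h2 => hnoy0 q (by omega) h2)]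
    exact hRz_s
  -- `ℓ(z)` is on at `s`, constant on `[t+1, s]`, so the event turned it on: a creation, opposite parities
  have hLz_t1 : Lr (t + 1) (y t) := (iff_of_steps (P := fun k => Lr k (y t)) (show t + 1 ≤ s by omega)
    (fun k h1 h2 => hLz_const k h1 h2)).mp hLz_s
  have hLz_t : ¬ Lr t (y t) := fun h => (hfLz.mp hLz_t1) h
  have hgz : ¬ ((Even (y t + e) → S t (y t) < S t (x t)) ∧ (¬ Even (y t + e) → S t (x t) < S t (y t))) := by
    rw [← hSem t (by omega) (x t) (y t) huz hzn hLu (fun q h1 h2 => (hgap q h1 h2).1)]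
    exact hLz_t
  have hgu : ¬ ((Even (x t + e) → S t (x t) < S t (y t)) ∧ (¬ Even (x t + e) → S t (y t) < S t (x t))) := by
    rw [← hSemR t (by omega) (x t) (y t) huz hzn hRz (fun q h1 h2 => (hgap q h1 h2).2)]
    exact hRu_t
  obtain ⟨hpar, hzE, hzO⟩ := parity_clash (hdis t (by omega) (y t) (x t) hzn hun (by omega)) hgz hgu
  have huy0 := (hSemR s hsT.le (x t) (y s) huy0 hy0n hRy0 hnoy0).mp hRs
  have hadj_z : S s (y t) < S s (x t) ↔ S s (y t) < S s (y s) := by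
    have := hadj s hsT (y t) hzn (by omega) (by omega)
    rwa [← huxs] at this
  have hne_zy0 := hdis s hsT.le (y t) (y s) hzn hy0n (by omega)
  have hne_zu := hdis s hsT.le (y t) (x t) hzn hun (by omega)
  apply hgood_z
  by_cases hz : Even (y t + e)
  · have hu : ¬ Even (x t + e) := hpar.mp hz
    -- `z` even: above `u` at `t`, below from `t+1` on; `u` odd with `r(u)` on at `s`: `y₀ < u`... so `z < u < `… derive `z < y₀`
    have h1 : S s (y t) < S s (x t) := by
      have h2 : ¬ S (t + 1) (x t) < S (t + 1) (y t) := hft.mp (hzE hz)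
      rw [← hper] at h2
      exact lt_of_le_of_ne (not_lt.mp h2) hne_zu
    exact ⟨fun _ => hadj_z.mp h1, fun h => absurd hz h⟩
  · have hu : Even (x t + e) := by
      by_contra h
      exact hz (hpar.mpr h)
    have h1 : S s (x t) < S s (y t) := by
      have h2 : S t (y t) < S t (x t) := hzO hz
      have h3 : ¬ S t (x t) < S t (y t) := fun h => lt_asymm h h2
      have h4 : S (t + 1) (x t) < S (t + 1) (y t) := by
        by_contra h5
        exact h3 (hft.mpr h5)
      exact hper.mpr h4
    refine ⟨fun h => absurd h hz, fun _ => ?_⟩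
    have h3 : ¬ S s (y t) < S s (y s) := fun h => lt_asymm h1 (hadj_z.mpr h |> fun h' => h')
    · exact lt_of_le_of_ne (not_lt.mp h3) (Ne.symm hne_zy0)

end Anatomy

end StaticPathFold

end Summit.ValiantsHypothesis.ValiantsHypothesis.Theorems.KPlusLogSqLaw
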